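import Summits.ResolutionOfSingularities.ResolutionOfSingularities.Theorems.FrobeniusLadderFInjectiveMacaulayficationNewtonChartLemmaInitialForm
import Mathlib.Algebra.CharP.Lemmas
import HarnessLib

/-!
# BED T (lx3p3): `f = z² + x⁴z + y⁴ + u⁴ + t⁵` IS NEWTON NON-DEGENERATE in characteristic `3` (the `hND` binder of the class row `fHalfRow_of_newtonNondegenerate'`)
# (crux `FInjectiveMacaulayfication` stmt-ResolutionOfSingularities-15315, chain w45a; res-L1-w45a-plan-1 RULINGS R21.8 (2) / R21.10 (2) «BED T: ND of f by a hand lemma; tri-2 confirms»;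
# seat res-L1-w45a-stub-1 g12; the face criterion and its exhaustive check = res-L1-w45a-tri-2 g16 l.82534 (26 + 5 faces); letters = stub-2's fan module)

[OURS · L1 W4.5a] Support file (`--supports stmt-ResolutionOfSingularities-15315 --as helper`); def-free; UNCONDITIONAL; no named fact; NOT a statement of any manuscript.
AI-written (AI review is weaker than expert review).

* §1 GENERIC (ns `NewtonChartLemma`): `initialForm_coe_real` — for ANY real weight `w` the BGM initial form of a polynomial is the polynomial of its terms of minimal `w`-weight;
  `eval_pderiv_sum_monomial_eq_single` — if `α₀` is the only exponent of a face with a non-zero `i`-th coordinate, then `∂_i` of the face polynomial evaluated at `q` is the single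
  term `a_{α₀} · α₀ᵢ · q^{α₀ − eᵢ}`; `eval_monomial_ne_zero_of_torus`.
* §2 BED T (ns `Lx3p3Specimen`): `f_eq_sum_monomial`, `support_f_subset` (`supp f ⊆ {z², x⁴z, y⁴, u⁴, t⁵}`), ★★ `isNewtonNondegenerate_f` — **`f` is Newton non-degenerate over
  every field of characteristic `3`**: for a positive weight `w` let `F ≠ ∅` be the exponents of minimal weight; if `y⁴ ∈ F` then `∂_y In_w f (q) = a·4·q_y³ ≠ 0` (no other
  monomial carries `y`), else if `u⁴ ∈ F` use `∂_u`, else if `t⁵ ∈ F` use `∂_t` (`5 = 2 ≠ 0`), else if `x⁴z ∈ F` use `∂_x` (`x³z`-term; `z²` carries no `x`), else `F = {z²}`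
  and `∂_z = 2z ≠ 0` — tri-2's face criterion, all 31 faces at once.
[cite: IshiiSingularities2018, Def. 4.4.22 (p. 95)] [cite: BoubakriGreuelMarkwig2010, §3 (p. 10)]
-/

-- single-problem summit: the doubled namespace component is forced
set_option linter.dupNamespace false

noncomputable section

open MvPolynomial

namespace Summit.ResolutionOfSingularities.ResolutionOfSingularities.Theorems.FInjectiveMacaulayfication

open Literature.AlgebraicGeometry.Resolution Literature.AlgebraicGeometry.Resolution.BoubakriGreuelMarkwig

/-! ## §1 Generic: real-weight initial forms of polynomials; one-term partial derivatives of face polynomials -/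

namespace NewtonChartLemma

variable {k : Type} [Field k] {m : ℕ}

/-- For ANY real weight `w`, the BGM initial form of a polynomial `f` is the polynomial of its terms of minimal `w`-weight. [cite: BoubakriGreuelMarkwig2010, §3 (p. 10)] -/
theorem initialForm_coe_real (f : MvPolynomial (Fin m) k) (w : Fin m → ℝ) [DecidablePred fun α : Fin m →₀ ℕ => ∀ β ∈ f.support, wdeg w α ≤ wdeg w β] :
    initialForm w (f : MvPowerSeries (Fin m) k) =
      ((∑ α ∈ f.support.filter (fun α => ∀ β ∈ f.support, wdeg w α ≤ wdeg w β), monomial α (coeff α f) : MvPolynomial (Fin m) k) : MvPowerSeries (Fin m) k) := by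
  classical
  ext α
  rw [MvPolynomial.coeff_coe, coeff_sum]
  simp only [coeff_monomial, Finset.sum_ite_eq', Finset.mem_filter]
  rw [MvPowerSeries.coeff_apply]
  unfold initialForm
  have key : (α ∈ supp (f : MvPowerSeries (Fin m) k) ∧ ∀ β ∈ supp (f : MvPowerSeries (Fin m) k), wdeg w α ≤ wdeg w β) ↔
      (α ∈ f.support ∧ ∀ β ∈ f.support, wdeg w α ≤ wdeg w β) := by
    rw [supp_coe]
    simp only [Finset.mem_coe]
  by_cases hα : α ∈ f.support ∧ ∀ β ∈ f.support, wdeg w α ≤ wdeg w β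
  · rw [if_pos (key.mpr hα), if_pos hα, MvPolynomial.coeff_coe]
  · rw [if_neg (fun h => hα (key.mp h)), if_neg hα]

/-- If `α₀ ∈ F` is the only exponent of `F` with a non-zero `i`-th coordinate, then `∂_i (Σ_{α ∈ F} c_α X^α)` evaluated at `q` is the single term `c_{α₀} · α₀ᵢ · q^{α₀ − eᵢ}`. [folklore] -/
theorem eval_pderiv_sum_monomial_eq_single (F : Finset (Fin m →₀ ℕ)) (c : (Fin m →₀ ℕ) → k) (i : Fin m) (α₀ : Fin m →₀ ℕ) (h0 : α₀ ∈ F)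
    (hF : ∀ α ∈ F, α ≠ α₀ → α i = 0) (q : Fin m → k) :
    MvPolynomial.eval q (pderiv i (∑ α ∈ F, monomial α (c α))) = c α₀ * (α₀ i : k) * ∏ j, q j ^ (α₀ - Finsupp.single i 1 : Fin m →₀ ℕ) j := by
  rw [map_sum, map_sum, Finset.sum_eq_single_of_mem α₀ h0]
  · rw [pderiv_monomial, eval_monomial, Finsupp.prod_fintype _ _ (fun j => by simp)]
  · intro α hα hne
    rw [pderiv_monomial, hF α hα hne, Nat.cast_zero, mul_zero, monomial_zero, map_zero]

/-- On the torus a monomial term with non-zero coefficient does not vanish. [folklore] -/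
theorem mul_prod_pow_ne_zero (c a : k) (hc : c ≠ 0) (ha : a ≠ 0) (q : Fin m → k) (hq : ∀ j, q j ≠ 0) (β : Fin m →₀ ℕ) :
    c * a * ∏ j, q j ^ β j ≠ 0 :=
  mul_ne_zero (mul_ne_zero hc ha) (Finset.prod_ne_zero_iff.mpr fun j _ => pow_ne_zero _ (hq j))

end NewtonChartLemma

/-! ## §2 BED T: `f = z² + x⁴z + y⁴ + u⁴ + t⁵` is Newton non-degenerate in characteristic 3 -/

namespace Lx3p3Specimen

variable (k : Type) [Field k]

/-- `f` as a sum of five monomials. [plumbing] -/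
theorem f_eq_sum_monomial (f : MvPolynomial (Fin 5) k) (hf : f = X 4 ^ 2 + X 0 ^ 4 * X 4 + X 1 ^ 4 + X 2 ^ 4 + X 3 ^ 5) :
    f = monomial (Finsupp.single 4 2) 1 + monomial (Finsupp.single 0 4 + Finsupp.single 4 1) 1 + monomial (Finsupp.single 1 4) 1 +
      monomial (Finsupp.single 2 4) 1 + monomial (Finsupp.single 3 5) 1 := by
  rw [hf, X_pow_eq_monomial, X_pow_eq_monomial, X_pow_eq_monomial, X_pow_eq_monomial, X_pow_eq_monomial,
    show (X 4 : MvPolynomial (Fin 5) k) = monomial (Finsupp.single 4 1) 1 from rfl, monomial_mul, one_mul]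

/-- The support of `f` consists of the five exponents `z², x⁴z, y⁴, u⁴, t⁵`. [plumbing] -/
theorem support_f_subset (f : MvPolynomial (Fin 5) k) (hf : f = X 4 ^ 2 + X 0 ^ 4 * X 4 + X 1 ^ 4 + X 2 ^ 4 + X 3 ^ 5)
    (α : Fin 5 →₀ ℕ) (hα : α ∈ f.support) :
    α = Finsupp.single 4 2 ∨ α = Finsupp.single 0 4 + Finsupp.single 4 1 ∨ α = Finsupp.single 1 4 ∨ α = Finsupp.single 2 4 ∨ α = Finsupp.single 3 5 := by
  classical
  rw [mem_support_iff, f_eq_sum_monomial k f hf] at hα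
  simp only [coeff_add, coeff_monomial] at hα
  by_contra hcon
  push Not at hcon
  obtain ⟨n1, n2, n3, n4, n5⟩ := hcon
  rw [if_neg (Ne.symm n1), if_neg (Ne.symm n2), if_neg (Ne.symm n3), if_neg (Ne.symm n4), if_neg (Ne.symm n5)] at hα
  simp at hα

/-- `(4 : k) ≠ 0`, `(5 : k) ≠ 0`, `(2 : k) ≠ 0` in characteristic `3`. [plumbing] -/
theorem casts_ne_zero [CharP k 3] : (4 : k) ≠ 0 ∧ (5 : k) ≠ 0 ∧ (2 : k) ≠ 0 := by
  have h3 : (3 : k) = 0 := by exact_mod_cast CharP.cast_eq_zero k 3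
  have h1 : (1 : k) ≠ 0 := one_ne_zero
  refine ⟨fun h => h1 ?_, fun h => h1 ?_, fun h => h1 ?_⟩
  · linear_combination h - h3
  · linear_combination -h + 2 * h3
  · linear_combination h3 - h

/-- ★★ **`f = z² + x⁴z + y⁴ + u⁴ + t⁵` IS NEWTON NON-DEGENERATE over every field of characteristic `3`** (Ishii Def. 4.4.22 = BGM `IsNewtonNondegenerate`, `k`-rational torus points):
for a positive weight `w` with face `F` (the exponents of minimal weight, non-empty), `∂_y` / `∂_u` / `∂_t` / `∂_x` / `∂_z` of the face polynomial is a SINGLE monomial with unit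
coefficient according as `y⁴ ∈ F` / `u⁴ ∈ F` / `t⁵ ∈ F` / `x⁴z ∈ F` / `F = {z²}` — res-L1-w45a-tri-2's face criterion (l.82534), all 31 faces at once. (Fails in characteristic
`2` — `∂_z(z²) = 0` — and `5`.) [OURS · certificate; cite: IshiiSingularities2018, Def. 4.4.22] -/
theorem isNewtonNondegenerate_f [CharP k 3] (f : MvPolynomial (Fin 5) k) (hf : f = X 4 ^ 2 + X 0 ^ 4 * X 4 + X 1 ^ 4 + X 2 ^ 4 + X 3 ^ 5) :
    IsNewtonNondegenerate (f : MvPowerSeries (Fin 5) k) := by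
  classical
  obtain ⟨h4, h5, h2⟩ := casts_ne_zero k
  intro w hw q hq hJ
  rw [NewtonChartLemma.initialForm_coe_real f w] at hJ
  unfold IsJacobianZero at hJ
  simp only [NewtonChartLemma.pderiv_coe, NewtonChartLemma.evalAt_coe] at hJ
  set F := f.support.filter (fun α => ∀ β ∈ f.support, wdeg w α ≤ wdeg w β) with hFdef
  have hFsub : ∀ α ∈ F, α ∈ f.support := fun α hα => (Finset.mem_filter.mp hα).1
  have hcoef : ∀ α ∈ F, coeff α f ≠ 0 := fun α hα => mem_support_iff.mp (hFsub α hα)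
  -- `F ≠ ∅`: the weight attains its minimum on the non-empty support
  have hf0 : f ≠ 0 := by
    intro h0
    have := congrArg (MvPolynomial.eval (Pi.single 4 1 : Fin 5 → k)) h0
    rw [hf] at this
    simp at this
  obtain ⟨αm, hαm, hmin⟩ := Finset.exists_min_image f.support (wdeg w) (support_nonempty.mpr hf0)
  have hαmF : αm ∈ F := Finset.mem_filter.mpr ⟨hαm, hmin⟩
  have hsup := support_f_subset k f hf
  -- the single-term evaluation, packaged
  have single : ∀ (i : Fin 5) (α₀ : Fin 5 →₀ ℕ), α₀ ∈ F → (∀ α ∈ F, α ≠ α₀ → α i = 0) → ((α₀ i : ℕ) : k) ≠ 0 → False := by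
    intro i α₀ h0 hF hi
    have h := hJ i
    rw [NewtonChartLemma.eval_pderiv_sum_monomial_eq_single F (fun α => coeff α f) i α₀ h0 hF q] at h
    exact NewtonChartLemma.mul_prod_pow_ne_zero _ _ (hcoef α₀ h0) hi q hq _ h
  by_cases hy : (Finsupp.single 1 4 : Fin 5 →₀ ℕ) ∈ F
  · refine single 1 _ hy (fun α hα hne => ?_) (by simpa using h4)
    rcases hsup α (hFsub α hα) with rfl | rfl | rfl | rfl | rfl
    · simp
    · simp
    · exact absurd rfl hne
    · simp
    · simp
  by_cases hu : (Finsupp.single 2 4 : Fin 5 →₀ ℕ) ∈ F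
  · refine single 2 _ hu (fun α hα hne => ?_) (by simpa using h4)
    rcases hsup α (hFsub α hα) with rfl | rfl | rfl | rfl | rfl
    · simp
    · simp
    · simp
    · exact absurd rfl hne
    · simp
  by_cases ht : (Finsupp.single 3 5 : Fin 5 →₀ ℕ) ∈ F
  · refine single 3 _ ht (fun α hα hne => ?_) (by simpa using h5)
    rcases hsup α (hFsub α hα) with rfl | rfl | rfl | rfl | rfl
    · simp
    · simp
    · simp
    · simp
    · exact absurd rfl hne
  by_cases hx : (Finsupp.single 0 4 + Finsupp.single 4 1 : Fin 5 →₀ ℕ) ∈ F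
  · refine single 0 _ hx (fun α hα hne => ?_) (by simpa using h4)
    rcases hsup α (hFsub α hα) with rfl | rfl | rfl | rfl | rfl
    · simp
    · exact absurd rfl hne
    · exact absurd hα hy
    · exact absurd hα hu
    · exact absurd hα ht
  -- only `z²` is left
  have hz : (Finsupp.single 4 2 : Fin 5 →₀ ℕ) ∈ F := by
    rcases hsup αm hαm with h | h | h | h | h
    · exact h ▸ hαmF
    · exact absurd (h ▸ hαmF) hx
    · exact absurd (h ▸ hαmF) hy
    · exact absurd (h ▸ hαmF) hu
    · exact absurd (h ▸ hαmF) ht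
  refine single 4 _ hz (fun α hα hne => ?_) (by simpa using h2)
  rcases hsup α (hFsub α hα) with rfl | rfl | rfl | rfl | rfl
  · exact absurd rfl hne
  · exact absurd hα hx
  · simp
  · simp
  · simp

end Lx3p3Specimen

end Summit.ResolutionOfSingularities.ResolutionOfSingularities.Theorems.FInjectiveMacaulayfication

end
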